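import Summits.KontsevichZagierPeriods.KontsevichZagierPeriods.Theses.HurwitzMicroSectors
import Summits.KontsevichZagierPeriods.KontsevichZagierPeriods.Theorems.HurwitzMicroSectorsNormalFormPrinciplePiBoxTransfer
import Summits.KontsevichZagierPeriods.KontsevichZagierPeriods.Theorems.HurwitzMicroSectorsNormalFormPrincipleVariants2239
import Summits.KontsevichZagierPeriods.KontsevichZagierPeriods.Theorems.HurwitzMicroSectorsNormalFormPrincipleVariants2296

/-! TTRL-lite variant V2297 of stmt-KontsevichZagierPeriods-3869

Variant V2297 = `stub_boxRigidity` (the leaf `BoxRigidity` of `NormalFormPrinciple`: two BOX-RATIONAL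
representations — domain the open unit box, integrand `p/q` over `ℚ`, `q ≠ 0` on the box — with equal
values are KZ-equivalent) under the JOINT small-case move `bound_nat:m≤5; bound_nat:m'≤6` (hypotheses in
the order `m' ≤ 6 → m ≤ 5`). Verdict of the attempt seat: **open** — this file is the exact-strength
certificate, not a proof of the variant. The statement is literally the left-hand side of the tree's
`boxRigidityLe_iff_boxVanishing 5 6` (file `…Variants2239`: a joint bound `m ≤ j, m' ≤ k` is BoxVanishing
in the single dimension `max j k` — `⇒` compare with the zero representation on the `0`-box and use the
symmetry of `Equivalent`; `⇐` pad both representations to the common box by unit intervals and subtract,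
value `0` by soundness), so **V2297 ⟺ BoxVanishing 6** (every box-rational representation on `(0,1)⁶` of
value `0` is a Kontsevich–Zagier relation; `stub_boxRigidity_var2297_iff_boxVanishing_six`), hence
`V2297 ⟺ BoxRigidity for all m, m' ≤ 6` (`…_iff_le_six`: the bound `m ≤ 5` is idle next to `m' ≤ 6`) and
`V2297 ⟺ V2296` (`fix_nat:m=5; bound_nat:m'≤6`, `…_iff_var2296`). Why open: BoxVanishing 6 contains, by
monotonicity (`boxVanishing_le_six_of_stub_boxRigidity_var2297`), BoxVanishing 5 — for every `c : ℚ`,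
"`ζ(5) = c ⇒ [(0,1)⁵, 1/(1 − x₁⋯x₅) − c]` is a relation" — and BoxVanishing 2 (Catalan's `G`, `π log 2`,
`log² 2`, Clausen values against `ℚ`); the side conditions of the calculus' moves do not see values, so a
proof must decide such dichotomies — irrationality theorems nobody has; the proved two-sided level is
`max j k ≤ 1` (`boxRigidityLe_of_max_le_one`, Baker). Conversely `KontsevichZagierPeriods ⟹ parent ⟹ V2297`
(`stub_boxRigidity_var2297_of_statement`), so `¬ V2297` would refute the Summit (Conjecture 1 for the
tree's calculus), and the tree has no invariant of `KZ.relations` finer than `eval`.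
Residual goal: `BoxVanishing 6`.
Source: M. Kontsevich, D. Zagier, *Periods* (2001), §1.2 Conjecture 1 and rules 1)–3).
Pure proof file, no definitions. -/

-- `Summit.<Summit>.<Problem>` is the tree's mandated summit-side namespace (CONVENTIONS §2); for this
-- single-conjunct summit the two coincide, so the duplicate is deliberate.
set_option linter.dupNamespace false

noncomputable section

namespace Summit.KontsevichZagierPeriods.KontsevichZagierPeriods.Theorems

open MeasureTheory Set
open Literature.NumberTheory.Transcendental Literature.NumberTheory.Transcendental.KZ
open Summit.KontsevichZagierPeriods.KontsevichZagierPeriods.Theses.HurwitzMicroSectors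
open Summit.KontsevichZagierPeriods.HurwitzMicroSectors.NormalFormPrinciple.PiBox

/-! ## The variant V2297 is exactly `BoxVanishing 6` -/

/-- **V2297 ⟺ `BoxVanishing 6`** (instance `j = 5`, `k = 6` of `boxRigidityLe_iff_boxVanishing`,
`max 5 6 = 6`: a joint bound on both dimensions is Conjecture 1 for box-rational periods of the single
dimension `max j k`). [cite: KontsevichZagier2001, §1.2 Conjecture 1] -/
theorem stub_boxRigidity_var2297_iff_boxVanishing_six :
    (∀ (m m' : ℕ) (N : IntegralRep m) (N' : IntegralRep m'), m' ≤ 6 → m ≤ 5 → N.domain = {x | ∀ i, x i ∈ Set.Ioo (0:ℝ) 1} → N.IsRational → N'.domain = {x | ∀ i, x i ∈ Set.Ioo (0:ℝ) 1} → N'.IsRational → N.value = N'.value → Equivalent N N') ↔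
    (∀ (M : IntegralRep 6), M.domain = {x | ∀ i, x i ∈ Set.Ioo (0:ℝ) 1} → M.IsRational →
      M.value = 0 → of M ∈ relations) :=
  boxRigidityLe_iff_boxVanishing 5 6

/-- **V2297 ⟺ `BoxRigidity` for all `m, m' ≤ 6`** (the honest strength of the variant: Conjecture 1
for all pairs of rational integrands on the open unit boxes of dimension at most `6`; the bound `m ≤ 5`
is idle next to `m' ≤ 6`, by padding). [cite: KontsevichZagier2001, §1.2 Conjecture 1] -/
theorem stub_boxRigidity_var2297_iff_le_six :
    (∀ (m m' : ℕ) (N : IntegralRep m) (N' : IntegralRep m'), m' ≤ 6 → m ≤ 5 → N.domain = {x | ∀ i, x i ∈ Set.Ioo (0:ℝ) 1} → N.IsRational → N'.domain = {x | ∀ i, x i ∈ Set.Ioo (0:ℝ) 1} → N'.IsRational → N.value = N'.value → Equivalent N N') ↔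
    (∀ (m m' : ℕ) (N : IntegralRep m) (N' : IntegralRep m'), m' ≤ 6 → m ≤ 6 →
      N.domain = {x | ∀ i, x i ∈ Set.Ioo (0:ℝ) 1} → N.IsRational →
      N'.domain = {x | ∀ i, x i ∈ Set.Ioo (0:ℝ) 1} → N'.IsRational →
      N.value = N'.value → Equivalent N N') :=
  ⟨fun h => boxRigidityLe_of_boxVanishing (j := 6) (k := 6) le_rfl le_rfl
      (stub_boxRigidity_var2297_iff_boxVanishing_six.1 h),
    fun h m m' N N' hm' hm => h m m' N N' hm' (hm.trans (by norm_num))⟩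

/-- **V2297 ⟺ the sibling V2296** (`fix_nat:m=5; bound_nat:m'≤6`): both are `BoxVanishing 6`
(`stub_boxRigidity_var2296_iff_boxVanishing_six`, file `…Variants2296`) — bounding `m ≤ 5` and
freezing `m = 5` give the same statement. [cite: KontsevichZagier2001, §1.2 Conjecture 1] -/
theorem stub_boxRigidity_var2297_iff_var2296 :
    (∀ (m m' : ℕ) (N : IntegralRep m) (N' : IntegralRep m'), m' ≤ 6 → m ≤ 5 → N.domain = {x | ∀ i, x i ∈ Set.Ioo (0:ℝ) 1} → N.IsRational → N'.domain = {x | ∀ i, x i ∈ Set.Ioo (0:ℝ) 1} → N'.IsRational → N.value = N'.value → Equivalent N N') ↔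
    (∀ (m' : ℕ) (N : IntegralRep 5) (N' : IntegralRep m'), m' ≤ 6 → N.domain = {x | ∀ i, x i ∈ Set.Ioo (0:ℝ) 1} → N.IsRational → N'.domain = {x | ∀ i, x i ∈ Set.Ioo (0:ℝ) 1} → N'.IsRational → N.value = N'.value → Equivalent N N') :=
  stub_boxRigidity_var2297_iff_boxVanishing_six.trans stub_boxRigidity_var2296_iff_boxVanishing_six.symm

/-- **V2297 ⇒ `BoxVanishing` in every dimension `≤ 6`** (monotonicity by padding, `boxVanishing_mono`):
in particular the dimension-`5` statement containing the `ζ(5)` dichotomy and the dimension-`2`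
statement containing Catalan's. [cite: KontsevichZagier2001, §1.2 Conjecture 1] -/
theorem boxVanishing_le_six_of_stub_boxRigidity_var2297
    (h : ∀ (m m' : ℕ) (N : IntegralRep m) (N' : IntegralRep m'), m' ≤ 6 → m ≤ 5 → N.domain = {x | ∀ i, x i ∈ Set.Ioo (0:ℝ) 1} → N.IsRational → N'.domain = {x | ∀ i, x i ∈ Set.Ioo (0:ℝ) 1} → N'.IsRational → N.value = N'.value → Equivalent N N')
    {j : ℕ} (hj : j ≤ 6) (N : IntegralRep j) (hNd : N.domain = {x | ∀ i, x i ∈ Set.Ioo (0:ℝ) 1})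
    (hNr : N.IsRational) (hv : N.value = 0) : of N ∈ relations :=
  boxVanishing_mono hj (stub_boxRigidity_var2297_iff_boxVanishing_six.1 h) N hNd hNr hv

/-! ## Upper bounds: the parent leaf and the Summit imply V2297 -/

/-- **The parent leaf ⇒ V2297** (the two bounds are simply dropped; the converse is not claimed — the
parent is BoxVanishing in ALL dimensions). [cite: KontsevichZagier2001, §1.2 Conjecture 1] -/
theorem stub_boxRigidity_var2297_of_parent
    (h : ∀ (m m' : ℕ) (N : IntegralRep m) (N' : IntegralRep m'), N.domain = {x | ∀ i, x i ∈ Set.Ioo (0:ℝ) 1} → N.IsRational → N'.domain = {x | ∀ i, x i ∈ Set.Ioo (0:ℝ) 1} → N'.IsRational → N.value = N'.value → Equivalent N N') :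
    ∀ (m m' : ℕ) (N : IntegralRep m) (N' : IntegralRep m'), m' ≤ 6 → m ≤ 5 → N.domain = {x | ∀ i, x i ∈ Set.Ioo (0:ℝ) 1} → N.IsRational → N'.domain = {x | ∀ i, x i ∈ Set.Ioo (0:ℝ) 1} → N'.IsRational → N.value = N'.value → Equivalent N N' :=
  fun m m' N N' _ _ => h m m' N N'

/-- **`KontsevichZagierPeriods ⇒ V2297`**: the variant is a special case of Conjecture 1 for the tree's
calculus (`leaves_of_statement`) — so a refutation of the variant would refute the Summit.
[cite: KontsevichZagier2001, §1.2 Conjecture 1] -/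
theorem stub_boxRigidity_var2297_of_statement (h : _root_.KontsevichZagierPeriods) :
    ∀ (m m' : ℕ) (N : IntegralRep m) (N' : IntegralRep m'), m' ≤ 6 → m ≤ 5 → N.domain = {x | ∀ i, x i ∈ Set.Ioo (0:ℝ) 1} → N.IsRational → N'.domain = {x | ∀ i, x i ∈ Set.Ioo (0:ℝ) 1} → N'.IsRational → N.value = N'.value → Equivalent N N' :=
  stub_boxRigidity_var2297_of_parent (leaves_of_statement h).1

end Summit.KontsevichZagierPeriods.KontsevichZagierPeriods.Theorems

end
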